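import Summits.RiemannHypothesis.RiemannHypothesis.Theorems.Splittings.RobinFiniteTailFree
import Literature.NumberTheory.LFunctions.NicolasCriterionProofs
import Literature.NumberTheory.LFunctions.ThetaSmallRange
import Literature.NumberTheory.LFunctions.RiemannHypothesisUpTo100000X
import HarnessLib

/-!
# E1c⁺ part 1 — the RH-free explicit formula with its EXACT limit (U1) and the UPPER zero split under RH up to `T` (U2)

Pub cell `rh-split` (robin, finite) gen 10, CARVE-g10 part 1/3 of the checked object `SketchG10-Upper.lean` (bodies verbatim,
one shared namespace `Summit.RiemannHypothesis.RiemannHypothesis.Theorems.Splittings.RobinFiniteE1c`).  Zero `def`, zero `sorry`,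
no `native_decide` in this file; everything RH-shaped is a HYPOTHESIS `RiemannHypothesisUpTo T` except the one instance discharged by
the tree theorem `riemannHypothesisUpTo_100000` (part 3).
SPLITTING SEARCH over kernel-typed RH-EQUIVALENCES; a splitting A ∧ B ⟹ RH is CONDITIONAL bookkeeping unless A and B are
both proved; nothing here bears on the truth of RH.
-/

set_option linter.dupNamespace false

noncomputable section

open Complex Filter Set MeasureTheory Topology intervalIntegral
open scoped Real Chebyshev ComplexConjugate

namespace Summit.RiemannHypothesis.RiemannHypothesis.Theorems.Splittings.RobinFiniteE1c

open Literature.NumberTheory.LFunctions Literature.NumberTheory.DiophantineGeometry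
open Nicolas NicolasJ NicolasFz NicolasK NicolasJExplicit

/-! ### U1 · the RH-free explicit formula in limit form, with its EXACT limit (two-sided form of `explicitFormulaFree_holds`) -/

/-- **S1, two-sided** (RH-free): for `x > 1`, `∫_x^X (ψ(t) − t) w₀(t) dt` converges as `X → ∞` to
`Re(−Σ_ρ (m/ρ)F_ρ(x)) − log(2π)/(x log x) − Re(E(x)w₀(x) + ∫_x^∞ E w₀')` (`E` = the trivial zeros' remainder of the
explicit formula for `ψ₁`).  The proof is `explicitFormulaFree_holds` verbatim with the limit value exposed. -/
theorem explicitFormula_limit {x : ℝ} (hx : 1 < x) :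
    Tendsto (fun X : ℝ ↦ ∫ t in x..X, (ψ t - t) * w0 t) atTop
      (𝓝 ((-∑' ρ : Zeros, (riemannZetaZeroOrder (ρ : ℂ) : ℂ) / (ρ : ℂ) * Fz (ρ : ℂ) x).re
        - Real.log (2 * π) / (x * Real.log x)
        - (psiOneRemainder x * (w0 x : ℂ) + ∫ t in Ioi x, psiOneRemainder t * (w0' t : ℂ)).re)) := by
  have hx0 : 0 < x := by linarith
  have hlx : 0 < Real.log x := Real.log_pos hx
  obtain ⟨C, hC0, hC⟩ := exists_norm_psiOneRemainder_le
  obtain ⟨hiLr, hL⟩ := linear_term hx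
  have hiL : IntegrableOn (fun t : ℝ ↦ (t : ℂ) * (w0' t : ℂ)) (Ioi x) := by
    have h0 : IntegrableOn (fun t : ℝ ↦ ((t * w0' t : ℝ) : ℂ)) (Ioi x) := hiLr.ofReal (𝕜 := ℂ)
    exact h0.congr_fun (fun t _ ↦ by push_cast; ring) measurableSet_Ioi
  have hiE := integrableOn_psiOneRemainder_mul_w0' hx hC
  have hLC : (x : ℂ) * (w0 x : ℂ) + ∫ t in Ioi x, (t : ℂ) * (w0' t : ℂ) = ((-(1 / (x * Real.log x)) : ℝ) : ℂ) := by
    rw [← hL]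
    push_cast
    rw [← integral_complex_ofReal]
    congr 1
    refine setIntegral_congr_fun measurableSet_Ioi fun t _ ↦ ?_
    push_cast; ring
  obtain ⟨Lc, hLc⟩ : ∃ Lc : ℂ, Lc = -(∑' ρ : Zeros, (riemannZetaZeroOrder (ρ : ℂ) : ℂ) / (ρ : ℂ) * Fz (ρ : ℂ) x)
      + Complex.log (2 * π) * ((x : ℂ) * (w0 x : ℂ) + ∫ t in Ioi x, (t : ℂ) * (w0' t : ℂ))
      - (psiOneRemainder x * (w0 x : ℂ) + ∫ t in Ioi x, psiOneRemainder t * (w0' t : ℂ)) := ⟨_, rfl⟩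
  have hre : Lc.re = (-(∑' ρ : Zeros, (riemannZetaZeroOrder (ρ : ℂ) : ℂ) / (ρ : ℂ) * Fz (ρ : ℂ) x)).re
      - Real.log (2 * π) / (x * Real.log x)
      - (psiOneRemainder x * (w0 x : ℂ) + ∫ t in Ioi x, psiOneRemainder t * (w0' t : ℂ)).re := by
    rw [hLc, hLC, log_two_pi, sub_re, add_re, ← Complex.ofReal_mul, Complex.ofReal_re]
    ring
  rw [← hre]
  -- the pieces and their limits
  have hT1 : Tendsto (fun y : ℝ ↦ ∑' ρ : Zeros, (riemannZetaZeroOrder (ρ : ℂ) : ℂ) / (ρ : ℂ) * Fz (ρ : ℂ) y) atTop (𝓝 0) :=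
    tendsto_termSum
  have hw0b : ∀ X, x ≤ X → w0 X ≤ (1 / Real.log x + 1 / Real.log x ^ 2) / X ^ 2 := fun X hX ↦ w0_le hx hX
  have hT2 : Tendsto (fun X : ℝ ↦ (X : ℂ) * (w0 X : ℂ)) atTop (𝓝 0) := by
    have hr : Tendsto (fun X : ℝ ↦ X * w0 X) atTop (𝓝 0) := by
      have hmaj : Tendsto (fun X : ℝ ↦ (1 / Real.log x + 1 / Real.log x ^ 2) * X⁻¹) atTop (𝓝 0) := by
        have h := tendsto_inv_atTop_zero.const_mul (1 / Real.log x + 1 / Real.log x ^ 2)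
        rw [mul_zero] at h
        exact h
      refine squeeze_zero_norm' ?_ hmaj
      filter_upwards [eventually_ge_atTop x] with X hX
      have hX0 : 0 < X := hx0.trans_le hX
      rw [Real.norm_eq_abs, abs_of_pos (mul_pos hX0 (w0_pos (hx.trans_le hX)))]
      calc X * w0 X ≤ X * ((1 / Real.log x + 1 / Real.log x ^ 2) / X ^ 2) :=
            mul_le_mul_of_nonneg_left (hw0b X hX) hX0.le
        _ = (1 / Real.log x + 1 / Real.log x ^ 2) * X⁻¹ := by field_simp
    have h2 := (Complex.continuous_ofReal.tendsto 0).comp hr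
    rw [Complex.ofReal_zero] at h2
    exact h2.congr fun X ↦ by simp only [Function.comp_apply, Complex.ofReal_mul]
  have hT3 : Tendsto (fun X : ℝ ↦ ∫ t in x..X, (t : ℂ) * (w0' t : ℂ)) atTop
      (𝓝 (∫ t in Ioi x, (t : ℂ) * (w0' t : ℂ))) := intervalIntegral_tendsto_integral_Ioi x hiL tendsto_id
  have hT4 : Tendsto (fun X : ℝ ↦ psiOneRemainder X * (w0 X : ℂ)) atTop (𝓝 0) := by
    have hmaj : Tendsto (fun X : ℝ ↦ C * (1 / Real.log x + 1 / Real.log x ^ 2) * X ^ (-(3 / 2) : ℝ))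
        atTop (𝓝 0) := by
      have h := (tendsto_rpow_neg_atTop (y := (3 / 2 : ℝ)) (by norm_num)).const_mul
        (C * (1 / Real.log x + 1 / Real.log x ^ 2))
      rw [mul_zero] at h
      exact h
    refine squeeze_zero_norm' ?_ hmaj
    filter_upwards [eventually_ge_atTop x] with X hX
    have hX0 : 0 < X := hx0.trans_le hX
    rw [norm_mul, Complex.norm_real, Real.norm_eq_abs, abs_of_pos (w0_pos (hx.trans_le hX))]
    calc ‖psiOneRemainder X‖ * w0 X ≤ (C * Real.sqrt X) * ((1 / Real.log x + 1 / Real.log x ^ 2) / X ^ 2) :=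
          mul_le_mul (hC X hX0) (hw0b X hX) (w0_pos (hx.trans_le hX)).le (by positivity)
      _ = C * (1 / Real.log x + 1 / Real.log x ^ 2) * X ^ (-(3 / 2) : ℝ) := by
          rw [Real.sqrt_eq_rpow, show (X ^ 2 : ℝ) = X ^ (1 / 2 : ℝ) * X ^ (3 / 2 : ℝ) by
              rw [← Real.rpow_add hX0]; norm_num, Real.rpow_neg hX0.le]
          have : X ^ (3 / 2 : ℝ) ≠ 0 := (Real.rpow_pos_of_pos hX0 _).ne'
          have : X ^ (1 / 2 : ℝ) ≠ 0 := (Real.rpow_pos_of_pos hX0 _).ne'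
          field_simp
  have hT5 : Tendsto (fun X : ℝ ↦ ∫ t in x..X, psiOneRemainder t * (w0' t : ℂ)) atTop
      (𝓝 (∫ t in Ioi x, psiOneRemainder t * (w0' t : ℂ))) :=
    intervalIntegral_tendsto_integral_Ioi x hiE tendsto_id
  obtain ⟨EXPR, hEXPR⟩ : ∃ F : ℝ → ℂ, F = fun X ↦ (-(∑' ρ : Zeros, (riemannZetaZeroOrder (ρ : ℂ) : ℂ) / (ρ : ℂ) * Fz (ρ : ℂ) x) + (∑' ρ : Zeros, (riemannZetaZeroOrder (ρ : ℂ) : ℂ) / (ρ : ℂ) * Fz (ρ : ℂ) X))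
      - Complex.log (2 * π) *
          ((X : ℂ) * (w0 X : ℂ) - (x : ℂ) * (w0 x : ℂ) - ∫ t in x..X, (t : ℂ) * (w0' t : ℂ))
      + (psiOneRemainder X * (w0 X : ℂ) - psiOneRemainder x * (w0 x : ℂ)
          - ∫ t in x..X, psiOneRemainder t * (w0' t : ℂ)) := ⟨_, rfl⟩
  have hlimE : Tendsto EXPR atTop (𝓝 Lc) := by
    have h := (((tendsto_const_nhds (x := -(∑' ρ : Zeros, (riemannZetaZeroOrder (ρ : ℂ) : ℂ) / (ρ : ℂ) * Fz (ρ : ℂ) x))).add hT1).sub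
      (((hT2.sub (tendsto_const_nhds (x := (x : ℂ) * (w0 x : ℂ)))).sub hT3).const_mul
        (Complex.log (2 * π)))).add
      ((hT4.sub (tendsto_const_nhds (x := psiOneRemainder x * (w0 x : ℂ)))).sub hT5)
    have e : -(∑' ρ : Zeros, (riemannZetaZeroOrder (ρ : ℂ) : ℂ) / (ρ : ℂ) * Fz (ρ : ℂ) x) + 0
        - Complex.log (2 * π) * (0 - (x : ℂ) * (w0 x : ℂ) - ∫ t in Ioi x, (t : ℂ) * (w0' t : ℂ))
        + (0 - psiOneRemainder x * (w0 x : ℂ) - ∫ t in Ioi x, psiOneRemainder t * (w0' t : ℂ)) = Lc := by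
      rw [hLc]; ring
    rw [hEXPR, ← e]
    exact h
  have hG : ∀ X, x ≤ X → ((∫ t in x..X, (ψ t - t) * w0 t : ℝ) : ℂ) = EXPR X := by
    intro X hxX
    have hX : 1 < X := hx.trans_le hxX
    have hIcc : uIcc x X = Icc x X := uIcc_of_le hxX
    rw [integral_R_mul_w0_eq hx hxX, Complex.ofReal_sub, Complex.ofReal_sub, Complex.ofReal_mul,
      Complex.ofReal_mul, ← intervalIntegral.integral_ofReal]
    have hinside : ∫ t in x..X, ((Rone t * w0' t : ℝ) : ℂ) =
        ∫ t in x..X, (-(Zsum t * (w0' t : ℂ)) - Complex.log (2 * π) * ((t : ℂ) * (w0' t : ℂ))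
          + psiOneRemainder t * (w0' t : ℂ)) := by
      refine intervalIntegral.integral_congr fun t ht ↦ ?_
      rw [hIcc] at ht
      push_cast
      rw [Rone_eq_explicit (hx.le.trans ht.1)]; ring
    have hw0'c : ContinuousOn (fun t : ℝ ↦ (w0' t : ℂ)) (uIcc x X) := by
      rw [hIcc]
      exact Complex.continuous_ofReal.comp_continuousOn (continuousOn_w0'.mono fun t ht ↦ hx.trans_le ht.1)
    have hiZ : IntervalIntegrable (fun t : ℝ ↦ -(Zsum t * (w0' t : ℂ))) volume x X := by
      refine (ContinuousOn.mul ?_ hw0'c).intervalIntegrable.neg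
      rw [hIcc]; exact continuousOn_Zsum.mono fun t ht ↦ (hx.le.trans ht.1)
    have hiLi : IntervalIntegrable (fun t : ℝ ↦ Complex.log (2 * π) * ((t : ℂ) * (w0' t : ℂ))) volume x X := by
      refine ((ContinuousOn.mul ?_ hw0'c).intervalIntegrable).const_mul _
      exact Complex.continuous_ofReal.continuousOn
    have hiEi : IntervalIntegrable (fun t : ℝ ↦ psiOneRemainder t * (w0' t : ℂ)) volume x X := by
      refine (ContinuousOn.mul ?_ hw0'c).intervalIntegrable
      rw [hIcc]; exact continuousOn_psiOneRemainder.mono fun t ht ↦ (hx.le.trans ht.1)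
    rw [hinside, intervalIntegral.integral_add (hiZ.sub hiLi) hiEi, intervalIntegral.integral_sub hiZ hiLi,
      intervalIntegral.integral_neg, intervalIntegral.integral_const_mul,
      Rone_eq_explicit hx.le, Rone_eq_explicit hX.le, hEXPR]
    have hZ := zeros_part_interval hx hxX
    beta_reduce
    linear_combination hZ
  have hGlim : Tendsto (fun X : ℝ ↦ ((∫ t in x..X, (ψ t - t) * w0 t : ℝ) : ℂ)) atTop (𝓝 Lc) := by
    refine hlimE.congr' ?_
    filter_upwards [eventually_ge_atTop x] with X hX
    exact (hG X hX).symm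
  have hre' := (Complex.continuous_re.tendsto Lc).comp hGlim
  exact hre'.congr fun X ↦ by simp only [Function.comp_apply, Complex.ofReal_re]

/-- **S1⁺, the UPPER explicit-formula bound** (RH-free): for `x ≥ 2` the limit `L = lim_X ∫_x^X (ψ(t) − t) w₀(t) dt`
satisfies `L ≤ Re(−Σ_ρ (m/ρ)F_ρ(x))` — the trivial zeros' bracket is `≥ −(x/(2(x²−1))) w₀(x)`
(`NicolasUpper.re_remainder_bracket_ge`) and that small negative is absorbed by the linear term `−log(2π)/(x log x)`
(the absorption step of `NicolasUpper.nicolasJ_le_of_RH`, verbatim).  Mirror of the lower bound in `explicitFormulaFree_holds`. -/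
theorem explicitFormula_upper {x : ℝ} (hx : 2 ≤ x) :
    ∃ L : ℝ, Tendsto (fun X : ℝ ↦ ∫ t in x..X, (ψ t - t) * w0 t) atTop (𝓝 L) ∧
      L ≤ (-∑' ρ : Zeros, (riemannZetaZeroOrder (ρ : ℂ) : ℂ) / (ρ : ℂ) * Fz (ρ : ℂ) x).re := by
  have hx1 : 1 < x := by linarith
  have hx0 : 0 < x := by linarith
  refine ⟨_, explicitFormula_limit hx1, ?_⟩
  obtain ⟨C, -, hC⟩ := exists_norm_psiOneRemainder_le
  have hE := NicolasUpper.re_remainder_bracket_ge hx1 hC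
  have hlx : 0 < Real.log x := Real.log_pos hx1
  have hl2 : (0.6931471803 : ℝ) < Real.log x :=
    lt_of_lt_of_le Real.log_two_gt_d9 (Real.log_le_log (by norm_num) hx)
  have habs : x / (2 * (x ^ 2 - 1)) * w0 x ≤ Real.log (2 * π) / (x * Real.log x) := by
    have h2π : 1 ≤ Real.log (2 * π) := by
      rw [Real.le_log_iff_exp_le (by positivity)]
      have h1 := Real.exp_one_lt_d9
      have h2 := Real.pi_gt_three
      linarith
    have hx21 : 0 < x ^ 2 - 1 := by nlinarith
    have hinv : 1 / Real.log x ≤ 3 / 2 := by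
      rw [div_le_div_iff₀ hlx (by norm_num)]; linarith
    have hw0le : w0 x ≤ 4 / x ^ 2 := by
      rw [w0, NicolasFz.wt]
      refine div_le_div_of_nonneg_right ?_ (by positivity)
      have hsq : 1 / Real.log x ^ 2 = (1 / Real.log x) ^ 2 := by rw [one_div_pow]
      rw [hsq]
      nlinarith [hinv, one_div_pos.2 hlx]
    have step1 : x / (2 * (x ^ 2 - 1)) * w0 x ≤ x / (2 * (x ^ 2 - 1)) * (4 / x ^ 2) :=
      mul_le_mul_of_nonneg_left hw0le (by positivity)
    have step2 : x / (2 * (x ^ 2 - 1)) * (4 / x ^ 2) = 2 / (x * (x ^ 2 - 1)) := by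
      field_simp; ring
    have step3 : 2 / (x * (x ^ 2 - 1)) ≤ 1 / (x * Real.log x) := by
      rw [div_le_div_iff₀ (by positivity) (by positivity)]
      have hlog := Real.log_le_sub_one_of_pos hx0
      nlinarith
    have step4 : 1 / (x * Real.log x) ≤ Real.log (2 * π) / (x * Real.log x) :=
      div_le_div_of_nonneg_right h2π (by positivity)
    linarith
  linarith [hE, habs]


/-! ### U2 · the UPPER zero split under RH up to `T` (mirror of `zeroSplitBound_holds`) -/

/-- **S2⁺, the UPPER partial-RH zero split**: for `x > 1`, RH up to height `T` and the weighted off-line bound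
`Σ_{|γ|>T} m(ρ) x^{Re ρ − 1/2}/γ² ≤ D` give `Re(−Σ_ρ (m/ρ)F_ρ(x)) ≤ 0.0463·(1/(√x log x) + D_x) + (1 + 2/log x)·D/(√x log x)`
(the zeros with `|γ| ≤ T` are on the line: Nicolas 2012 (2.2)–(2.3) per zero and Ford's `Σ m/|ρ|² ≤ 0.0463`; every other zero
through the off-line majorant `offline_term_le`).  Same per-zero majorants as `zeroSplitBound_holds`; only the last step
(`Re(−Σ f) ≤ ‖Σ f‖ ≤ Σ ‖f‖`) differs. -/
theorem zeroSplitBound_upper {T x D : ℝ} (hx : 1 < x) (hT : RiemannHypothesisUpTo T)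
    (hoff : ∑' ρ : RHWave0.riemannZetaNontrivialZeros,
      (if T < |(ρ : ℂ).im| then
        (riemannZetaZeroOrder (ρ : ℂ) : ℝ) * x ^ ((ρ : ℂ).re - 1 / 2) / (ρ : ℂ).im ^ 2 else 0) ≤ D) :
    (-∑' ρ : Zeros, (riemannZetaZeroOrder (ρ : ℂ) : ℂ) / (ρ : ℂ) * Fz (ρ : ℂ) x).re ≤
      0.0463 * (1 / (Real.sqrt x * Real.log x) + Dx x)
        + (1 + 2 / Real.log x) * D * (1 / (Real.sqrt x * Real.log x)) := by
  have hx0 : 0 < x := by linarith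
  have hlx : 0 < Real.log x := Real.log_pos hx
  have hsx : 0 < Real.sqrt x := Real.sqrt_pos.2 hx0
  set a : ℝ := 1 / (Real.sqrt x * Real.log x) + Dx x with ha
  set c : ℝ := (1 + 2 / Real.log x) / (Real.sqrt x * Real.log x) with hc
  have ha0 : 0 ≤ a := by rw [ha]; have := Dx_pos hx; positivity
  have hc0 : 0 ≤ c := by rw [hc]; positivity
  set f : Zeros → ℂ := fun ρ ↦ (riemannZetaZeroOrder (ρ : ℂ) : ℂ) / (ρ : ℂ) * Fz (ρ : ℂ) x with hf
  set gon : Zeros → ℝ := fun ρ ↦ if |(ρ : ℂ).im| ≤ T then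
      (riemannZetaZeroOrder (ρ : ℂ) : ℝ) * (a / ‖(ρ : ℂ)‖ ^ 2) else 0 with hgon
  set w : Zeros → ℝ := fun ρ ↦ if T < |(ρ : ℂ).im| then
      (riemannZetaZeroOrder (ρ : ℂ) : ℝ) * x ^ ((ρ : ℂ).re - 1 / 2) / (ρ : ℂ).im ^ 2 else 0 with hw
  have hpt : ∀ ρ, ‖f ρ‖ ≤ gon ρ + c * w ρ := by
    intro ρ
    by_cases hρ : |(ρ : ℂ).im| ≤ T
    · have hre : (ρ : ℂ).re = 1 / 2 := LiIndexSets.re_eq_half_of_abs_im_le hT ρ.2 hρ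
      have h := online_term_le ρ hx hre
      have hwz : w ρ = 0 := by rw [hw]; simp [not_lt.2 hρ]
      have hg : gon ρ = (riemannZetaZeroOrder (ρ : ℂ) : ℝ) * (a / ‖(ρ : ℂ)‖ ^ 2) := by rw [hgon]; simp [hρ]
      rw [hwz, hg, mul_zero, add_zero, ha]
      exact h
    · have hlt : T < |(ρ : ℂ).im| := not_le.1 hρ
      have h := offline_term_le ρ hx
      have hg : gon ρ = 0 := by rw [hgon]; simp [hρ]
      have hwρ : w ρ = (riemannZetaZeroOrder (ρ : ℂ) : ℝ) * x ^ ((ρ : ℂ).re - 1 / 2) / (ρ : ℂ).im ^ 2 := by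
        rw [hw]; simp [hlt]
      rw [hg, zero_add, hwρ, hc]
      exact h
  have hFord := FordL33.summable_order_div_norm_sq
  have hgon_s : Summable gon := by
    refine (hFord.mul_left a).of_nonneg_of_le (fun ρ ↦ ?_) (fun ρ ↦ ?_)
    · simp only [hgon]; split_ifs
      · have := FordL33.order_pos ρ; positivity
      · exact le_rfl
    · have hm := FordL33.order_pos ρ
      simp only [hgon]; split_ifs
      · exact le_of_eq (by ring)
      · positivity
  have hw_s : Summable w := summable_offWeight hx T
  have hmaj_s : Summable (fun ρ ↦ gon ρ + c * w ρ) := hgon_s.add (hw_s.mul_left c)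
  have hgon_le : ∑' ρ, gon ρ ≤ a * 0.0463 := by
    have h1 : ∑' ρ, gon ρ ≤ ∑' ρ : Zeros, a * ((riemannZetaZeroOrder (ρ : ℂ) : ℝ) / ‖(ρ : ℂ)‖ ^ 2) := by
      refine hgon_s.tsum_le_tsum (fun ρ ↦ ?_) (hFord.mul_left a)
      have hm := FordL33.order_pos ρ
      simp only [hgon]; split_ifs
      · exact le_of_eq (by ring)
      · positivity
    rw [tsum_mul_left] at h1
    exact h1.trans (mul_le_mul_of_nonneg_left tsum_zeroOrder_div_norm_sq_le ha0)
  have hw_le : ∑' ρ, c * w ρ ≤ c * D := by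
    rw [tsum_mul_left]
    exact mul_le_mul_of_nonneg_left hoff hc0
  have hnorm_s : Summable (fun ρ ↦ ‖f ρ‖) :=
    hmaj_s.of_nonneg_of_le (fun ρ ↦ norm_nonneg _) hpt
  have key : ‖∑' ρ, f ρ‖ ≤ a * 0.0463 + c * D := by
    calc ‖∑' ρ, f ρ‖ ≤ ∑' ρ, ‖f ρ‖ := norm_tsum_le_tsum_norm hnorm_s
      _ ≤ ∑' ρ, (gon ρ + c * w ρ) := hnorm_s.tsum_le_tsum hpt hmaj_s
      _ = ∑' ρ, gon ρ + ∑' ρ, c * w ρ := hgon_s.tsum_add (hw_s.mul_left c)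
      _ ≤ a * 0.0463 + c * D := add_le_add hgon_le hw_le
  have hre : (-∑' ρ : Zeros, f ρ).re ≤ ‖∑' ρ, f ρ‖ := by
    rw [Complex.neg_re]
    exact (neg_le_abs _).trans (Complex.abs_re_le_norm _)
  have e : 0.0463 * (1 / (Real.sqrt x * Real.log x) + Dx x)
      + (1 + 2 / Real.log x) * D * (1 / (Real.sqrt x * Real.log x)) = a * 0.0463 + c * D := by
    rw [ha, hc]; ring
  linarith

end Summit.RiemannHypothesis.RiemannHypothesis.Theorems.Splittings.RobinFiniteE1c

end
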